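import Summits.ABC.IUTFork.LDHSplitBadPrimeNumberField
import Summits.ABC.IUTFork.LDHBadMassWindow
import HarnessLib

/-!
# The fork at [IUTchIII] Corollary 3.12, L-DH level: the EXACT threshold for the one-bad-place family — `Cor312Of` at every
# depth iff `c(Pr(v₀)) ≤ 1`, FALSE at large depth iff `c(Pr(v₀)) > 1`

Proof-only companion (D-0012; 0 definitions, no `Prop` fact) of abc-iut-c312-3's `LDHSplitBadPrimeWitness.lean` (the family
`deepAtPlace p v₀ l N σ`, bad set `{v₀}`) and `LDHBadMassWindow.lean` (the NECESSARY side in bad-mass currency,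
`DHData.badMass_szpiro_of_cor312Of`), and of `LDHSplitBadPrimeNumberField.lean` (abc-iut-w5-d018, p430071); WAVE-5 prover
abc-iut-w5-d018 (gen 4). TAKES NO SIDE on [IUTchIII] Cor. 3.12.

Write `β := Pr(v₀) = n_{v₀}/[F₀:ℚ]` and `c(β) := (1/ℓ⋇)·Σ_{i<ℓ⋇} (i+1)²·β^{i+1}` (`ℓ⋇ = (l−1)/2`). For abc-iut-c312-3's synthetic
one-bad-place Θ-volume input `deepAtPlace p v₀ l N σ` over number fields `F₀ ⊆ K`:

* `deepAtPlace_explicitDeltaRest_eq` — abc-iut-S8's print-shaped Step (v) constant `explicitDeltaRest` of the input does NOT depend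
  on the depth `N` (definitional: it sees only the support primes, `ℓ⋇`, and the section `σ`);
* `deepAtPlace_ndeg_qPilot` — `deĝ̲(P_q) = N·e_{v₀}·ln N(v₀)/[F₀:ℚ]`, linear in `N`; `deepAtPlace_badMass_eq` — the bad mass at `p`
  IS `β = Pr(v₀)`;
* **`cor312Of_deepAtPlace_of_coeff_le_one`** — `c(β) ≤ 1` ⇒ `Cor312NonarchOf ∧ Cor312Of` at EVERY depth (abc-iut-c312-3's
  `cor312Of_of_badMass_le`, the bad mass at every prime being `≤ β`);
* **`exists_deepAtPlace_not_cor312Of_of_one_lt_coeff`** — `c(β) > 1` ⇒ SOME depth `N` has `¬ Cor312Of (deepAtPlace p v₀ l N σ)`: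
  by `badMass_szpiro_of_cor312Of` (with the admissible per-prime lower bound `μ ≡ P_q(v₀)·ln N(v₀)/n_{v₀}`, all summands
  nonnegative, the `p`-summand equal to `c(β)·deĝ̲(P_q)`) `Cor312Of` forces `(c(β) − 1)·N·e_{v₀}·ln N(v₀)/[F₀:ℚ] ≤ explicitDeltaRest +
  ((l+5)/4)·log π`, an `N`-free bound — impossible for large `N`;
* **`deepAtPlace_threshold`** — the dichotomy packaged: `(c(β) ≤ 1 → ∀ N, Cor312Of) ∧ (1 < c(β) → ∃ N, ¬ Cor312Of)`.

So along this family the typed inequality is decided EXACTLY by the sign of `c(Pr(v₀)) − 1`: e.g. `Pr(v₀) = 1` (one place over `p`,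
in particular `F₀ = ℚ`): `c = (ℓ⋇+1)(2ℓ⋇+1)/6 > 1`, FALSE deep (abc-iut-w5-d157); `Pr(v₀) ≤ 1/2`: `c ≤ 29/32`, TRUE always (p430071);
`Pr(v₀) = 2/3` (a degree-2 place of a cubic field): `c(2/3) = 11/9 > 1` at `ℓ⋇ = 2` (`l = 5`) but `c(2/3) → 0` as `l → ∞`
(`LDHSplitBadPrimeLargeL`): the SAME `(F₀, v₀)` moves from the FALSE side to the TRUE side as `l` grows.
HONEST SCOPE as the parent files: SYNTHETIC inhabitants of the input type (not initial Θ-data); theorems about OUR typed objects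
((Ind1) = all capsule-index permutations, STEPV-IND1-NOTE R2); `Cor312Of` is a hypothesis on the necessary side; no side taken;
typed ≠ proved. [cite: DupuyHilado2025, §1 (1.1), §3.3, §3.6, §4.7, §4.12] [cite: Mochizuki2012, IUTchIV Thm. 1.10 Step (v) p. 27–28]
[cite: Mochizuki2012, IUTchIII Cor. 3.12 p. 173–174] [claim: Mochizuki2012, status: disputed] for every IUT quotation.
-/

noncomputable section

open Finset NumberField IsDedekindDomain Literature.IUT.LogVolume

namespace Summit.ABC.IUTFork

variable {F₀ : Type} [Field F₀] [NumberField F₀] {K : Type} [Field K] [NumberField K] [Algebra F₀ K]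
variable (p : ℕ) [hp : Fact p.Prime] (v₀ : placesOver F₀ p) (l : ℕ) (hl : l.Prime) (h5 : 5 ≤ l)

/-! ## Closed forms along the family -/

section ClosedForms

variable (N : ℕ) (hN : 0 < N) (σ : PlaceSection F₀ K)

/-- `ℓ⋇ = (l−1)/2` for the synthetic input (definitional). [cite: DupuyHilado2025, §3.3] -/
theorem deepAtPlace_lstar : (ThetaVolumeInput.deepAtPlace p v₀ l hl h5 N hN σ).lstar = (l - 1) / 2 := rfl

/-- **The print-shaped Step (v) constant of the synthetic input is depth-free** (it sees only `T(I)`, `ℓ⋇`, `σ`; definitional).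
[cite: Mochizuki2012, IUTchIV Thm. 1.10 Step (v) p. 27–28] -/
theorem deepAtPlace_explicitDeltaRest_eq (N' : ℕ) (hN' : 0 < N') :
    DHData.explicitDeltaRest (ThetaVolumeInput.deepAtPlace p v₀ l hl h5 N hN σ) =
      DHData.explicitDeltaRest (ThetaVolumeInput.deepAtPlace p v₀ l hl h5 N' hN' σ) := rfl

/-- `v₀` is the only bad place of the synthetic input (over any prime). [cite: DupuyHilado2025, §3.3] -/
theorem deepAtPlace_lone {p' : ℕ} (v : placesOver F₀ p')
    (hv : v.1 ∈ (ThetaVolumeInput.deepAtPlace p v₀ l hl h5 N hN σ).X.S) : v.1 = v₀.1 := by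
  rw [ThetaVolumeInput.deepAtPlace_S, Finset.mem_singleton] at hv
  exact hv

/-- **The bad mass of the synthetic input at `p` is exactly `Pr(v₀)`.** [cite: DupuyHilado2025, §3.6] -/
theorem deepAtPlace_badMass_eq :
    ∑ v : placesOver F₀ p,
        ((ThetaVolumeInput.deepAtPlace p v₀ l hl h5 N hN σ).X.S : Set (HeightOneSpectrum (𝓞 F₀))).indicator
          (weight F₀) v.1 = weight F₀ v₀.1 :=
  DHData.badMass_eq_weight_of_lone _ v₀
    (by rw [ThetaVolumeInput.deepAtPlace_S]; exact Finset.mem_singleton_self _)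
    (fun v hv => Subtype.ext (deepAtPlace_lone p v₀ l hl h5 N hN σ v hv))

/-- `P_q(v₀) = N·e_{v₀}` for the synthetic input (`ord_{v₀}(q) = 2lN·e_{v₀}`, coefficient `ord/(2l)`). [cite: DupuyHilado2025, §3.3] -/
theorem deepAtPlace_qPilot_apply :
    (ThetaVolumeInput.deepAtPlace p v₀ l hl h5 N hN σ).X.qPilot v₀.1 = (N : ℝ) * ramIdx F₀ v₀.1 := by
  have hX : (ThetaVolumeInput.deepAtPlace p v₀ l hl h5 N hN σ).X = PilotData.deepAtPlace F₀ p v₀ l hl h5 N hN := rfl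
  have hl' : (PilotData.deepAtPlace F₀ p v₀ l hl h5 N hN).l = l := rfl
  have hmem : v₀.1 ∈ (PilotData.deepAtPlace F₀ p v₀ l hl h5 N hN).S := by
    rw [PilotData.deepAtPlace_S]; exact Finset.mem_singleton_self _
  rw [hX, PilotData.qPilot_apply_of_mem _ hmem, PilotData.deepAtPlace_ordq, hl']
  have hl0 : (l : ℝ) ≠ 0 := by exact_mod_cast hl.ne_zero
  push_cast
  field_simp

/-- **`deĝ̲(P_q) = N·e_{v₀}·ln N(v₀)/[F₀:ℚ]`** for the synthetic input — linear in the depth. [cite: DupuyHilado2025, §3.3] -/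
theorem deepAtPlace_ndeg_qPilot :
    FinDivisor.ndeg F₀ (ThetaVolumeInput.deepAtPlace p v₀ l hl h5 N hN σ).X.qPilot =
      (N : ℝ) * ramIdx F₀ v₀.1 * logNorm F₀ v₀.1 / Module.finrank ℚ F₀ := by
  have hX : (ThetaVolumeInput.deepAtPlace p v₀ l hl h5 N hN σ).X = PilotData.deepAtPlace F₀ p v₀ l hl h5 N hN := rfl
  have hl' : (PilotData.deepAtPlace F₀ p v₀ l hl h5 N hN).l = l := rfl
  rw [hX, PilotData.qPilot, map_sum, PilotData.deepAtPlace_S, Finset.sum_singleton, FinDivisor.ndeg_of,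
    PilotData.deepAtPlace_ordq, hl']
  have hl0 : (l : ℝ) ≠ 0 := by exact_mod_cast hl.ne_zero
  push_cast
  field_simp

end ClosedForms

/-! ## The TRUE side: `c(Pr(v₀)) ≤ 1` -/

/-- **`c(Pr(v₀)) ≤ 1` ⇒ `Cor312Of` at EVERY depth** for the one-bad-place family (`c(β) = (1/ℓ⋇)Σ_{i<ℓ⋇}(i+1)²β^{i+1}`): abc-iut-c312-3's
`cor312Of_of_badMass_le`, the bad mass at every prime being `≤ Pr(v₀)`. Synthetic input; typed objects; no side taken.
[claim: Mochizuki2012, status: disputed] [cite: DupuyHilado2025, §1 (1.1), §3.6] -/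
theorem cor312Of_deepAtPlace_of_coeff_le_one (N : ℕ) (hN : 0 < N) (σ : PlaceSection F₀ K)
    (hc : (1 / (((l - 1) / 2 : ℕ) : ℝ)) *
        ∑ i : Fin ((l - 1) / 2), ((((i : ℕ) : ℝ) + 1) ^ 2 * (weight F₀ v₀.1) ^ ((i : ℕ) + 1)) ≤ 1) :
    (ThetaVolumeInput.deepAtPlace p v₀ l hl h5 N hN σ).Cor312NonarchOf ∧
      (ThetaVolumeInput.deepAtPlace p v₀ l hl h5 N hN σ).Cor312Of := by
  set I := ThetaVolumeInput.deepAtPlace p v₀ l hl h5 N hN σ with hI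
  have hc' : ∀ p' ∈ I.supportPrimes, (1 / (I.lstar : ℝ)) * ∑ i : Fin I.lstar, (((i : ℕ) + 1 : ℝ) ^ 2) *
      (∑ v : placesOver F₀ p', (I.X.S : Set (HeightOneSpectrum (𝓞 F₀))).indicator (weight F₀) v.1) ^ ((i : ℕ) + 1) ≤ 1 := by
    intro p' _
    have hβ0 := I.badMass_nonneg p'
    have hβ := ThetaVolumeInput.deepAtPlace_badMass_le p v₀ l hl h5 N hN σ p'
    refine le_trans ?_ hc
    rw [show I.lstar = (l - 1) / 2 from rfl]
    refine mul_le_mul_of_nonneg_left (Finset.sum_le_sum fun i _ => ?_) (by positivity)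
    have := pow_le_pow_left₀ hβ0 hβ ((i : ℕ) + 1)
    nlinarith [sq_nonneg (((i : ℕ) : ℝ) + 1)]
  exact ⟨I.cor312NonarchOf_of_badMass_le hc', I.cor312Of_of_badMass_le hc'⟩

/-! ## The FALSE side: `c(Pr(v₀)) > 1` -/

/-- **`c(Pr(v₀)) > 1` ⇒ `Cor312Of` FAILS at SOME depth** for the one-bad-place family: abc-iut-c312-3's necessary condition
`DHData.badMass_szpiro_of_cor312Of` gives, under `Cor312Of`, `(c(β) − 1)·deĝ̲(P_q) ≤ explicitDeltaRest + ((l+5)/4)·log π` with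
`deĝ̲(P_q) = N·e_{v₀}·ln N(v₀)/[F₀:ℚ]` and a depth-free right side — impossible for large `N`. Synthetic input; typed objects; no
side taken. [claim: Mochizuki2012, status: disputed] [cite: DupuyHilado2025, §1 (1.1), §3.6, §4.7]
[cite: Mochizuki2012, IUTchIV Thm. 1.10 Step (v) p. 27–28] -/
theorem exists_deepAtPlace_not_cor312Of_of_one_lt_coeff (σ : PlaceSection F₀ K)
    (hc : 1 < (1 / (((l - 1) / 2 : ℕ) : ℝ)) *
        ∑ i : Fin ((l - 1) / 2), ((((i : ℕ) : ℝ) + 1) ^ 2 * (weight F₀ v₀.1) ^ ((i : ℕ) + 1))) :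
    ∃ (N : ℕ) (hN : 0 < N), ¬ (ThetaVolumeInput.deepAtPlace p v₀ l hl h5 N hN σ).Cor312Of := by
  set c : ℝ := (1 / (((l - 1) / 2 : ℕ) : ℝ)) *
    ∑ i : Fin ((l - 1) / 2), ((((i : ℕ) : ℝ) + 1) ^ 2 * (weight F₀ v₀.1) ^ ((i : ℕ) + 1)) with hcdef
  set I₁ := ThetaVolumeInput.deepAtPlace p v₀ l hl h5 1 Nat.one_pos σ with hI₁
  set R : ℝ := DHData.explicitDeltaRest I₁ + ThetaVolumeInput.archLogTheta l with hR
  -- the slope `q₁ = e_{v₀}·ln N(v₀)/[F₀:ℚ] > 0` of `deĝ̲(P_q)` in `N`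
  set q₁ : ℝ := (ramIdx F₀ v₀.1 : ℝ) * logNorm F₀ v₀.1 / Module.finrank ℚ F₀ with hq₁
  have he : (0 : ℝ) < ramIdx F₀ v₀.1 := by exact_mod_cast Nat.pos_of_ne_zero (ramIdx_ne_zero F₀ v₀.1)
  have hF : (0 : ℝ) < Module.finrank ℚ F₀ := by exact_mod_cast Module.finrank_pos
  have hq₁pos : 0 < q₁ := div_pos (mul_pos he (logNorm_pos F₀ v₀.1)) hF
  have hA : 0 < q₁ * (c - 1) := mul_pos hq₁pos (by linarith)
  obtain ⟨N, hN⟩ := exists_nat_gt (R / (q₁ * (c - 1)))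
  refine ⟨N + 1, Nat.succ_pos N, fun h312 => ?_⟩
  set I := ThetaVolumeInput.deepAtPlace p v₀ l hl h5 (N + 1) (Nat.succ_pos N) σ with hI
  -- the admissible per-prime lower bound: the `q`-slot value of `v₀`
  set μ0 : ℝ := I.X.qPilot v₀.1 * logNorm F₀ v₀.1 / (localDegree F₀ v₀.1 : ℝ) with hμ0
  have hμ : ∀ (p' : ℕ) (v : placesOver F₀ p'), v.1 ∈ I.X.S →
      (fun _ : ℕ => μ0) p' ≤ I.X.qPilot v.1 * logNorm F₀ v.1 / (localDegree F₀ v.1 : ℝ) := by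
    intro p' v hv
    have h := deepAtPlace_lone p v₀ l hl h5 (N + 1) (Nat.succ_pos N) σ v hv
    simp only [hμ0, h, le_refl]
  have hsz := DHData.badMass_szpiro_of_cor312Of I h312 (fun _ => μ0) hμ
  -- nonnegativity of `μ0` and of every summand
  have hqv₀ : I.X.qPilot v₀.1 = (((N + 1 : ℕ) : ℝ)) * ramIdx F₀ v₀.1 :=
    deepAtPlace_qPilot_apply p v₀ l hl h5 (N + 1) (Nat.succ_pos N) σ
  have hn : (0 : ℝ) < localDegree F₀ v₀.1 := by exact_mod_cast localDegree_pos F₀ v₀.1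
  have hμ0_nonneg : 0 ≤ μ0 := by
    rw [hμ0, hqv₀]
    exact div_nonneg (mul_nonneg (by positivity) (logNorm_pos F₀ v₀.1).le) hn.le
  have hp_mem : p ∈ I.supportPrimes := by
    have h := I.residueChar_mem_supportPrimes (v := v₀.1)
      (by rw [ThetaVolumeInput.deepAtPlace_S]; exact Finset.mem_singleton_self _)
    rwa [(mem_placesOver_iff_residueChar v₀.1).mp v₀.2] at h
  have hle : (1 / (I.X.lstar : ℝ)) * ∑ i : Fin I.X.lstar, (((i : ℕ) + 1 : ℝ) ^ 2) * μ0 *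
        (∑ v : placesOver F₀ p, (I.X.S : Set (HeightOneSpectrum (𝓞 F₀))).indicator (weight F₀) v.1) ^
          ((i : ℕ) + 1 + 1) ≤
      ∑ p' ∈ I.supportPrimes, (1 / (I.X.lstar : ℝ)) * ∑ i : Fin I.X.lstar, (((i : ℕ) + 1 : ℝ) ^ 2) * μ0 *
        (∑ v : placesOver F₀ p', (I.X.S : Set (HeightOneSpectrum (𝓞 F₀))).indicator (weight F₀) v.1) ^
          ((i : ℕ) + 1 + 1) := by
    refine Finset.single_le_sum (f := fun p' => (1 / (I.X.lstar : ℝ)) * ∑ i : Fin I.X.lstar,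
      (((i : ℕ) + 1 : ℝ) ^ 2) * μ0 *
        (∑ v : placesOver F₀ p', (I.X.S : Set (HeightOneSpectrum (𝓞 F₀))).indicator (weight F₀) v.1) ^
          ((i : ℕ) + 1 + 1)) (fun p' _ => ?_) hp_mem
    have hβ0 := I.badMass_nonneg p'
    exact mul_nonneg (by positivity) (Finset.sum_nonneg fun i _ =>
      mul_nonneg (mul_nonneg (sq_nonneg _) hμ0_nonneg) (pow_nonneg hβ0 _))
  -- evaluate the `p`-summand and `deĝ̲(P_q)`
  have hβ : ∑ v : placesOver F₀ p, (I.X.S : Set (HeightOneSpectrum (𝓞 F₀))).indicator (weight F₀) v.1 = weight F₀ v₀.1 :=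
    deepAtPlace_badMass_eq p v₀ l hl h5 (N + 1) (Nat.succ_pos N) σ
  have hL : I.X.lstar = (l - 1) / 2 := rfl
  have hterm : (1 / (I.X.lstar : ℝ)) * ∑ i : Fin I.X.lstar, (((i : ℕ) + 1 : ℝ) ^ 2) * μ0 *
        (∑ v : placesOver F₀ p, (I.X.S : Set (HeightOneSpectrum (𝓞 F₀))).indicator (weight F₀) v.1) ^
          ((i : ℕ) + 1 + 1) = μ0 * weight F₀ v₀.1 * c := by
    rw [hβ, hL, hcdef, Finset.mul_sum, Finset.mul_sum, Finset.mul_sum]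
    refine Finset.sum_congr rfl fun i _ => ?_
    ring
  have hndeg : FinDivisor.ndeg F₀ I.X.qPilot = μ0 * weight F₀ v₀.1 := by
    rw [deepAtPlace_ndeg_qPilot p v₀ l hl h5 (N + 1) (Nat.succ_pos N) σ, hμ0, hqv₀, weight]
    field_simp
  have hμβ : μ0 * weight F₀ v₀.1 = (((N + 1 : ℕ) : ℝ)) * q₁ := by
    rw [hμ0, hqv₀, weight, hq₁]
    field_simp
  -- depth-free right side
  have hRI : DHData.explicitDeltaRest I + ThetaVolumeInput.archLogTheta I.l = R := by
    rw [hR, deepAtPlace_explicitDeltaRest_eq p v₀ l hl h5 (N + 1) (Nat.succ_pos N) σ 1 Nat.one_pos]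
    rfl
  rw [hRI, hndeg] at hsz
  have hmain : μ0 * weight F₀ v₀.1 * c - μ0 * weight F₀ v₀.1 ≤ R := by linarith
  rw [hμβ] at hmain
  -- `(N+1)·q₁·(c−1) ≤ R` contradicts `N > R/(q₁(c−1))`
  have hkey : R < q₁ * (c - 1) * N := by rwa [div_lt_iff₀ hA, mul_comm] at hN
  have hcast : (((N + 1 : ℕ) : ℝ)) = (N : ℝ) + 1 := by push_cast; ring
  rw [hcast] at hmain
  nlinarith

/-! ## The dichotomy -/

/-- **THE EXACT THRESHOLD along the one-bad-place family.** With `β = Pr(v₀)` and `c(β) = (1/ℓ⋇)Σ_{i<ℓ⋇}(i+1)²β^{i+1}`: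
`c(β) ≤ 1` ⇒ `Cor312Of (deepAtPlace p v₀ l N σ)` for EVERY depth `N`; `c(β) > 1` ⇒ `¬ Cor312Of (deepAtPlace p v₀ l N σ)` for SOME
`N`. In the sharp Dupuy–Hilado-level model the typed inequality along this family is decided exactly by the sign of
`c(Pr(v₀)) − 1` — a function of `(l, n_{v₀}/[F₀:ℚ])` alone. Synthetic inputs; typed objects; no side taken on print's Cor. 3.12.
[claim: Mochizuki2012, status: disputed] [cite: DupuyHilado2025, §1 (1.1), §3.6, §4.7] -/
theorem deepAtPlace_threshold (σ : PlaceSection F₀ K) :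
    ((1 / (((l - 1) / 2 : ℕ) : ℝ)) *
          ∑ i : Fin ((l - 1) / 2), ((((i : ℕ) : ℝ) + 1) ^ 2 * (weight F₀ v₀.1) ^ ((i : ℕ) + 1)) ≤ 1 →
        ∀ (N : ℕ) (hN : 0 < N), (ThetaVolumeInput.deepAtPlace p v₀ l hl h5 N hN σ).Cor312Of) ∧
      (1 < (1 / (((l - 1) / 2 : ℕ) : ℝ)) *
          ∑ i : Fin ((l - 1) / 2), ((((i : ℕ) : ℝ) + 1) ^ 2 * (weight F₀ v₀.1) ^ ((i : ℕ) + 1)) →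
        ∃ (N : ℕ) (hN : 0 < N), ¬ (ThetaVolumeInput.deepAtPlace p v₀ l hl h5 N hN σ).Cor312Of) :=
  ⟨fun hc N hN => (cor312Of_deepAtPlace_of_coeff_le_one p v₀ l hl h5 N hN σ hc).2,
    fun hc => exists_deepAtPlace_not_cor312Of_of_one_lt_coeff p v₀ l hl h5 σ hc⟩

end Summit.ABC.IUTFork

end
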